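import Mathlib
import Literature.AlgebraicGeometry.Resolution.ResolutionLU
import Literature.AlgebraicGeometry.Resolution.LocalBlowup
import Literature.AlgebraicGeometry.Motives.RatFnSpec
import HarnessLib

/-!
# Route `RadicialJung`, crux `CleanModels` (stmt-15917), stub `stub_cleanLU3DefectNonDiscrete`, sub-line (C-div), stub D2 (`stub_cleanLU2`):
# EXTRACTION of a finitely generated model from a proper birational model, WITH the stalk and function-field identifications

Lead `res-B-lead-1` g5.  OURS; nothing here proves resolution in characteristic `p`.

`exists_model_of_proper_birational` — the proof of ✓ `exists_fg_regular_of_hasResolution` (`Literature/…/ResolutionLU.lean`,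
Zariski: resolution ⟹ local uniformization) re-run keeping the DATA: for `π : X → Spec A` proper birational (`X` integral),
`K = Frac A`, `O` a valuation ring of `K` over `A`, there are a point `x ∈ X` (the centre of `O`: `x = l(𝔪_O)` for the lift
`l : Spec O → X` of the valuative criterion), a finitely generated `A`-subalgebra `T ⊆ O` of `K` (the image of an affine
neighbourhood of `x`), a ring isomorphism `δ : 𝒪_{X,x} ≅ T_{𝔪_O ∩ T} = locAtCentre T O`, and a ring map `Θ : K(X) → K` with
`Θ ∘ (𝒪_{X,x} → K(X)) = (locAtCentre T O ⊆ K) ∘ δ` and `Θ ∘ π^♯ = (A ⊆ K)` on `A` (hence `Θ ∘ π^♯` is the identification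
`K(Spec A) = K`).  With these two compatibilities any statement about `𝒪_{X,x}` read in `K(X)` transports to `locAtCentre T O`
read in `K`.
-/

noncomputable section

set_option linter.dupNamespace false -- mandated namespace of this single-conjunct summit

open IsLocalRing AlgebraicGeometry CategoryTheory
open Literature.AlgebraicGeometry.Resolution Literature.AlgebraicGeometry.Motives

universe u

namespace Summit.ResolutionOfSingularities.ResolutionOfSingularities.Theorems.RadicialJung.CleanModels

variable {A : Type} [CommRing A] [IsDomain A] {K : Type} [Field K] [Algebra A K] [IsFractionRing A K]

/-- In `locAtCentre B O ⊆ K`, the localisation fraction `mk' y s` is the quotient `y / s` in `K`. [folklore] -/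
theorem coe_mk'_locAtCentre {B : Subring K} {O : ValuationSubring K} (h : B ≤ O.toSubring)
    (y : B) (s : (subringCentre B O h).primeCompl) :
    haveI := isLocalization_locAtCentre h
    ((IsLocalization.mk' (locAtCentre B O) y s : locAtCentre B O) : K) = (y : K) / ((s : B) : K) := by
  haveI := isLocalization_locAtCentre h
  have hs : O.valuation ((s : B) : K) = 1 := valuation_eq_one_of_not_mem_subringCentre h s.2
  have hs0 : ((s : B) : K) ≠ 0 := ne_zero_of_valuation_eq_one hs
  have hspec := IsLocalization.mk'_spec (locAtCentre B O) y s
  have h1 : ((IsLocalization.mk' (locAtCentre B O) y s : locAtCentre B O) : K) * ((s : B) : K) = (y : K) := by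
    have := congrArg (fun t : locAtCentre B O => (t : K)) hspec
    rw [Subring.coe_mul, locAtCentre.algebraMap_apply, locAtCentre.algebraMap_apply] at this
    exact this
  rw [eq_div_iff hs0, h1]

/-- **Extraction of a finitely generated model from a proper birational model, with the stalk and function-field
identifications** (see the module docstring). [folklore] -/
theorem exists_model_of_proper_birational (O : ValuationSubring K)
    (hAO : ∀ a : A, algebraMap A K a ∈ O)
    {X : Scheme.{0}} [IsIntegral X] (π : X ⟶ Spec (.of A)) [IsDominant π]
    (hproper : IsProper π) (hbir : IsBirational π) :
    ∃ (x : X) (T : Subalgebra A K) (_ : T.toSubring ≤ O.toSubring) (_ : T.FG)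
      (δ : X.presheaf.stalk x ≃+* locAtCentre T.toSubring O) (Θ : X.functionField →+* K),
      (∀ r : X.presheaf.stalk x,
        Θ (algebraMap (X.presheaf.stalk x) X.functionField r) = ((δ r : locAtCentre T.toSubring O) : K)) ∧
      (∀ s : Γ(Spec (.of A), ⊤), Θ (RatFn.functionFieldMap π
          ((Spec (.of A)).presheaf.germ ⊤ (genericPoint (Spec (.of A))) trivial s)) =
        algebraMap A K ((Scheme.ΓSpecIso (.of A)).hom s)) := by
  -- adapted from Literature/AlgebraicGeometry/Resolution/ResolutionLU.lean `exists_fg_regular_of_hasResolution`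
  classical
  haveI := hproper
  obtain ⟨U, hUd, -, hUiso⟩ := hbir
  haveI : IsDomain (CommRingCat.of A) := ‹IsDomain A›
  -- the ring maps `A → O → K`
  let φ₀ : A →+* O := (algebraMap A K).codRestrict O.toSubring hAO
  let ιOK : CommRingCat.of O ⟶ CommRingCat.of K := CommRingCat.ofHom (algebraMap O K)
  let i₂ : Spec (.of O) ⟶ Spec (.of A) := Spec.map (CommRingCat.ofHom φ₀)
  let g : Spec (.of K) ⟶ Spec (.of A) := Spec.map (CommRingCat.ofHom (algebraMap A K))
  have hg : Spec.map ιOK ≫ i₂ = g := by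
    rw [← Spec.map_comp]
    rfl
  -- the generic point of `Spec A` lies in `U`
  let q : Spec (.of K) := closedPoint K
  have hgq : g q = (⊥ : PrimeSpectrum A) := by
    change PrimeSpectrum.comap (algebraMap A K) (closedPoint K) = ⊥
    ext1
    rw [PrimeSpectrum.comap_asIdeal]
    change Ideal.comap (algebraMap A K) (maximalIdeal K) = ⊥
    rw [maximalIdeal_eq_bot, ← RingHom.ker_eq_comap_bot, RingHom.ker_eq_bot_iff_eq_zero]
    intro a ha
    exact (IsFractionRing.injective A K) (by rw [ha, map_zero])
  have hbotU : ((⊥ : PrimeSpectrum A) : Spec (.of A)) ∈ U := by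
    haveI : Nonempty (Spec (.of A)) := ⟨(⊥ : PrimeSpectrum A)⟩
    obtain ⟨y, hy⟩ := hUd.nonempty
    exact ((PrimeSpectrum.le_iff_specializes _ y).mp bot_le).mem_open U.isOpen hy
  have hrange : Set.range g.base ⊆ Set.range U.ι.base := by
    rw [Scheme.Opens.range_ι]
    rintro _ ⟨p, rfl⟩
    obtain rfl : p = q := Subsingleton.elim _ _
    rw [hgq]; exact hbotU
  let g₁ : Spec (.of K) ⟶ U := IsOpenImmersion.lift U.ι g hrange
  have hg₁ : g₁ ≫ U.ι = g := IsOpenImmersion.lift_fac _ _ _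
  haveI := hUiso
  let j : ↑(π ⁻¹ᵁ U) ⟶ X := (π ⁻¹ᵁ U).ι
  let i₁ : Spec (.of K) ⟶ X := g₁ ≫ inv (π ∣_ U) ≫ j
  have hsq : i₁ ≫ π = Spec.map ιOK ≫ i₂ := by
    rw [hg]
    simp only [i₁, j, Category.assoc, ← morphismRestrict_ι, IsIso.inv_hom_id_assoc, hg₁]
  -- valuative criterion of properness
  have hex : ValuativeCriterion.Existence π := by
    have h := (inferInstance : UniversallyClosed π)
    rw [UniversallyClosed.eq_valuativeCriterion] at h
    exact h.1
  obtain ⟨l, hl₁, hl₂⟩ :=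
    (hex { R := O, K := K, i₁ := i₁, i₂ := i₂, commSq := ⟨hsq⟩ }).exists_lift
  -- the centre `x' = l(𝔪_O)` and its integral local ring
  set c : Spec (.of O) := closedPoint O with hc
  let ψ := Scheme.stalkClosedPointTo l
  -- `ψ : 𝒪_{X,x'} → O` is injective
  have hψ : Function.Injective ψ := by
    let γ₀ : Spec (.of O) := Spec.map ιOK q
    have hγc : γ₀ ⤳ c := IsLocalRing.specializes_closedPoint γ₀
    -- (E1) at the generic point
    have hE1 : Function.Injective (l.stalkMap γ₀) := by
      have h1 : Function.Injective (g.stalkMap q) := by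
        have hF : IsField ((Spec (.of A)).presheaf.stalk (g q)) := by
          refine isField_stalk_of_eq ?_ (Field.toIsField (Spec (.of A)).functionField)
          rw [genericPoint_eq_bot_of_affine, hgq]
        letI := hF.toField
        exact RingHom.injective _
      have h2 : Function.Injective (g₁.stalkMap q) := by
        rw [← stalkMap_injective_congr hg₁, Scheme.Hom.stalkMap_comp] at h1
        exact Function.Injective.of_comp_right h1
          (ConcreteCategory.bijective_of_isIso (U.ι.stalkMap (g₁ q))).2
      have h3 : Function.Injective (i₁.stalkMap q) := by
        change Function.Injective ((g₁ ≫ inv (π ∣_ U) ≫ j).stalkMap q)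
        rw [Scheme.Hom.stalkMap_comp]
        exact h2.comp (ConcreteCategory.bijective_of_isIso ((inv (π ∣_ U) ≫ j).stalkMap _)).1
      rw [← stalkMap_injective_congr hl₁, Scheme.Hom.stalkMap_comp] at h3
      have h4 : Function.Injective ((Spec.map ιOK).stalkMap q ∘ l.stalkMap γ₀) := h3
      exact Function.Injective.of_comp h4
    -- (E2) generisation on `X` at the domain `𝒪_{X,x'}`
    have hE2 := stalkSpecializes_injective_of_isDomain (l.base.hom.map_specializes hγc)
    have hE := Scheme.Hom.stalkSpecializes_stalkMap l γ₀ c hγc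
    have hcomp : Function.Injective
        (l.stalkMap c ≫ (Spec (.of O)).presheaf.stalkSpecializes hγc) := by
      rw [← hE, CategoryTheory.hom_comp]
      exact hE1.comp hE2
    rw [CategoryTheory.hom_comp] at hcomp
    have hl : Function.Injective (l.stalkMap c) := Function.Injective.of_comp hcomp
    change Function.Injective (l.stalkMap c ≫ (stalkClosedPointIso (.of O)).hom)
    rw [CategoryTheory.hom_comp]
    exact (ConcreteCategory.bijective_of_isIso (stalkClosedPointIso (.of O)).hom).1.comp hl
  -- an affine neighbourhood `V ∋ x'`, of finite type over `A`
  obtain ⟨_, ⟨V, hV : IsAffineOpen V, rfl⟩, hxV, -⟩ :=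
    X.isBasis_affineOpens.exists_subset_of_mem_open (Set.mem_univ (l c)) isOpen_univ
  have hft : (π.appLE ⊤ V le_top).hom.FiniteType :=
    HasRingHomProperty.appLE (P := @LocallyOfFiniteType) π inferInstance ⟨⊤, isAffineOpen_top _⟩
      ⟨V, hV⟩ le_top
  let α : A →+* Γ(X, V) := (π.appLE ⊤ V le_top).hom.comp (Scheme.ΓSpecIso (.of A)).inv.hom
  have hα : α.FiniteType :=
    hft.comp (RingHom.FiniteType.of_surjective _
      (Scheme.ΓSpecIso (.of A)).symm.commRingCatIsoToRingEquiv.surjective)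
  let β : Γ(X, V) →+* O := ψ.hom.comp (X.presheaf.germ V (l c) hxV).hom
  -- compatibility `β ∘ α = (A → O)`
  have key1 : π.appLE ⊤ V le_top ≫ X.presheaf.germ V (l c) hxV =
      (Spec (.of A)).presheaf.germ ⊤ (π (l c)) trivial ≫ π.stalkMap (l c) := by
    rw [Scheme.Hom.germ_stalkMap, Scheme.Hom.appLE, Category.assoc, TopCat.Presheaf.germ_res]
  have key2 : (Spec (.of A)).presheaf.germ ⊤ ((l ≫ π) c) trivial ≫
      Scheme.stalkClosedPointTo (l ≫ π) = (Scheme.ΓSpecIso (.of A)).hom ≫ CommRingCat.ofHom φ₀ := by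
    rw [germ_stalkClosedPointTo_congr hl₂ ⊤ trivial]
    exact Scheme.germ_stalkClosedPointTo_Spec (CommRingCat.ofHom φ₀)
  have key3 : (Spec (.of A)).presheaf.germ ⊤ (π (l c)) trivial ≫ π.stalkMap (l c) ≫ ψ =
      (Scheme.ΓSpecIso (.of A)).hom ≫ CommRingCat.ofHom φ₀ := by
    rw [← key2, Scheme.stalkClosedPointTo_comp]
    rfl
  have key : (Scheme.ΓSpecIso (.of A)).inv ≫ π.appLE ⊤ V le_top ≫
      X.presheaf.germ V (l c) hxV ≫ ψ = CommRingCat.ofHom φ₀ := by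
    rw [← Category.assoc (π.appLE ⊤ V le_top), key1, Category.assoc, key3, Iso.inv_hom_id_assoc]
  have hβα : ∀ a, β (α a) = φ₀ a := fun a => by
    have := ConcreteCategory.congr_hom key a
    simp only [CategoryTheory.comp_apply, CommRingCat.hom_ofHom] at this
    exact this
  -- the prime of `Γ(X, V)` at `x'` is the preimage of `𝔪_O`
  letI algx := X.presheaf.algebra_section_stalk (⟨l c, hxV⟩ : V)
  have hlocx := hV.isLocalization_stalk ⟨l c, hxV⟩
  set 𝔮 := (hV.primeIdealOf ⟨l c, hxV⟩).asIdeal with h𝔮def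
  have h𝔮 : 𝔮 = Ideal.comap β (maximalIdeal O) := by
    rw [h𝔮def, IsAffineOpen.primeIdealOf_eq_map_closedPoint, Spec.map_apply,
      PrimeSpectrum.comap_asIdeal]
    change Ideal.comap (X.presheaf.germ V (l c) hxV).hom (maximalIdeal _) =
      Ideal.comap (ψ.hom.comp (X.presheaf.germ V (l c) hxV).hom) (maximalIdeal O)
    rw [← Ideal.comap_comap, IsLocalRing.maximalIdeal_comap ψ.hom]
  -- the uniformizing algebra `T = image of Γ(X, V)` in `K`
  letI : Algebra A Γ(X, V) := α.toAlgebra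
  haveI : Algebra.FiniteType A Γ(X, V) := hα
  let γ : Γ(X, V) →ₐ[A] K :=
    { (algebraMap O K).comp β with
      commutes' := fun a => by
        change algebraMap O K (β (α a)) = algebraMap A K a
        rw [hβα]; rfl }
  let T : Subalgebra A K := γ.range
  have hTfg : T.FG := by
    change (γ.range).FG
    rw [← Algebra.map_top]; exact Subalgebra.FG.map _ Algebra.FiniteType.out
  have hTO : T.toSubring ≤ O.toSubring := by
    rintro _ ⟨b, rfl⟩; exact (β b).2
  -- the centre of `O` on `T`
  set P : Ideal T.toSubring := subringCentre T.toSubring O hTO with hP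
  have hPmem : ∀ t : T.toSubring, t ∈ P ↔ (⟨(t : K), hTO t.2⟩ : O) ∈ maximalIdeal O := by
    intro t
    rw [hP, mem_subringCentre_iff, ValuationSubring.valuation_lt_one_iff]
  haveI hlocT : IsLocalization.AtPrime (locAtCentre T.toSubring O) P := isLocalization_locAtCentre hTO
  let γ' : Γ(X, V) →+* T.toSubring := γ.toRingHom.codRestrict T.toSubring (fun b => ⟨b, rfl⟩)
  have hγ' : ∀ b, ((γ' b : T.toSubring) : K) = (β b : K) := fun b => rfl
  have hγ'sur : Function.Surjective γ' := by
    rintro ⟨t, ⟨b, hb⟩⟩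
    exact ⟨b, Subtype.ext hb⟩
  have hPq : Ideal.comap γ' P = 𝔮 := by
    ext b
    rw [h𝔮, Ideal.mem_comap, hPmem, Ideal.mem_comap]
    rw [show (⟨((γ' b : T.toSubring) : K), hTO (γ' b).2⟩ : O) = β b from Subtype.ext rfl]
  have hMle : 𝔮.primeCompl ≤ P.primeCompl.comap γ' := fun b hb hb' => hb (by
    rw [← hPq]; exact hb')
  let δ : X.presheaf.stalk (l c) →+* locAtCentre T.toSubring O :=
    IsLocalization.map (locAtCentre T.toSubring O) γ' hMle
  have hδsurj : Function.Surjective δ := by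
    intro z
    obtain ⟨t, u, rfl⟩ := IsLocalization.exists_mk'_eq P.primeCompl z
    obtain ⟨b, rfl⟩ := hγ'sur t
    obtain ⟨s, hs⟩ := hγ'sur u
    have hsq : s ∉ 𝔮 := by
      intro hs𝔮
      rw [← hPq, Ideal.mem_comap, hs] at hs𝔮
      exact u.2 hs𝔮
    refine ⟨IsLocalization.mk' _ b (⟨s, hsq⟩ : 𝔮.primeCompl), ?_⟩
    rw [IsLocalization.map_mk']
    congr 1
    exact Subtype.ext hs
  have hδinj : Function.Injective δ := by
    rw [injective_iff_map_eq_zero]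
    intro z hz
    obtain ⟨b, s, rfl⟩ := IsLocalization.exists_mk'_eq 𝔮.primeCompl z
    rw [IsLocalization.map_mk', IsLocalization.mk'_eq_zero_iff] at hz
    obtain ⟨⟨m, hm⟩, hmb⟩ := hz
    have hm0 : m ≠ 0 := fun h => hm (by rw [h]; exact P.zero_mem)
    have hb0 : γ' b = 0 := (mul_eq_zero.mp hmb).resolve_left hm0
    have hβb : β b = 0 := by
      have h1 : ((γ' b : T.toSubring) : K) = 0 := by rw [hb0]; rfl
      rw [hγ'] at h1
      exact_mod_cast h1
    have hgerm : X.presheaf.germ V (l c) hxV b = 0 :=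
      hψ (by rw [map_zero]; exact hβb)
    rw [IsLocalization.mk'_eq_mul_mk'_one]
    change X.presheaf.germ V (l c) hxV b * _ = 0
    rw [hgerm, zero_mul]
  let δe : X.presheaf.stalk (l c) ≃+* locAtCentre T.toSubring O := RingEquiv.ofBijective δ ⟨hδinj, hδsurj⟩
  -- compatibility of `δ` with `ψ`: both read `germ b / germ s` as `β b / β s ∈ K`
  have hβunit : ∀ s : 𝔮.primeCompl, (β (s : Γ(X, V)) : K) ≠ 0 := by
    intro s hs0
    apply s.2
    have hβ0 : β (s : Γ(X, V)) = 0 := Subtype.ext hs0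
    have : (s : Γ(X, V)) ∈ Ideal.comap β (maximalIdeal O) := by
      rw [Ideal.mem_comap, hβ0]; exact Ideal.zero_mem _
    rwa [← h𝔮] at this
  have hδψ : ∀ r : X.presheaf.stalk (l c), ((δ r : locAtCentre T.toSubring O) : K) = algebraMap O K (ψ r) := by
    intro r
    obtain ⟨b, s, rfl⟩ := IsLocalization.exists_mk'_eq 𝔮.primeCompl r
    rw [IsLocalization.map_mk']
    -- left: `γ' b / γ' s`
    have hl : ((IsLocalization.mk' (locAtCentre T.toSubring O) (γ' b)
        (⟨γ' s, hMle s.2⟩ : P.primeCompl) : locAtCentre T.toSubring O) : K) = (β b : K) / (β (s : Γ(X, V)) : K) := by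
      exact coe_mk'_locAtCentre hTO (γ' b) ⟨γ' s, hMle s.2⟩
    rw [hl]
    -- right: `ψ (germ b / germ s) = β b / β s`
    have hspec := IsLocalization.mk'_spec (X.presheaf.stalk (l c)) b s
    have h2 : ψ (IsLocalization.mk' (X.presheaf.stalk (l c)) b s) * β (s : Γ(X, V)) = β b := by
      have := congrArg ψ hspec
      rw [map_mul] at this
      exact this
    have h3 : algebraMap O K (ψ (IsLocalization.mk' (X.presheaf.stalk (l c)) b s)) * (β (s : Γ(X, V)) : K) = (β b : K) := by
      have := congrArg (algebraMap O K) h2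
      rw [map_mul] at this
      exact this
    rw [div_eq_iff (hβunit s)]
    exact h3.symm
  -- `Θ : K(X) → K`, the extension of `ψ` to fraction fields
  have hιψ : Function.Injective ((algebraMap O K).comp ψ.hom) :=
    (IsFractionRing.injective O K).comp hψ
  let Θ : X.functionField →+* K := IsFractionRing.lift hιψ
  have hΘ : ∀ r : X.presheaf.stalk (l c), Θ (algebraMap _ X.functionField r) = algebraMap O K (ψ r) :=
    fun r => IsFractionRing.lift_algebraMap hιψ r
  refine ⟨l c, T, hTO, hTfg, δe, Θ, fun r => by rw [hΘ, ← hδψ]; rfl, fun s => ?_⟩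
  -- `Θ ∘ π^♯ = (A ⊆ K)` on `Γ(Spec A, ⊤) ≅ A`
  have e1 : (Spec (.of A)).presheaf.germ ⊤ (genericPoint (Spec (.of A))) trivial s =
      RatFn.toFunctionField (π (l c)) ((Spec (.of A)).presheaf.germ ⊤ (π (l c)) trivial s) := by
    rw [RatFn.toFunctionField_germ]
  rw [e1, RatFn.functionFieldMap_toFunctionField, RatFn.toFunctionField, hΘ]
  have := ConcreteCategory.congr_hom key3 s
  simp only [CategoryTheory.comp_apply, CommRingCat.hom_ofHom] at this
  change algebraMap O K (ψ (π.stalkMap (l c) _)) = _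
  rw [this]
  rfl

end Summit.ResolutionOfSingularities.ResolutionOfSingularities.Theorems.RadicialJung.CleanModels

end
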